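import Mathlib

/-! # T5LatticeBases — two bases of one lattice differ by a unit-determinant matrix; their
discriminants by the square of a unit

Blind cell pub-hodge-repro2, seat p4 (Tier-5 kernel annex, README §7; record-class, cited by p-id
or ignored, never an input). README §8(d): uses an L-value-free non-vanishing device: NO.

The elementary lattice fact behind «`v_F(disc O_{E_v})` is well defined» and behind the
comparison of the inverse different with the dual basis (route/T5-route-2.md §N5.13.2, (A13):
«the discriminant 4D of O_{F_v}[√D] equals the discriminant of O_{E_v} times the square of the
index ideal» — the index-square relation is `T5DiscriminantParity.discr_eq_det_toMatrix_sq_mul`;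
here: when two families span the SAME `A`-lattice the index is a unit):
* `exists_isUnit_det_of_span_eq` : two `A`-linearly independent families `c, c'` in an `A`-module
  with `span_A c' = span_A c` satisfy `c' j = ∑ i, P i j • c i` for a matrix `P` over `A` with
  `IsUnit P.det` (`Module.Basis.span`, `Module.Basis.isUnit_det`);
* `discr_eq_of_forall_eq_sum_smul` : `c' j = ∑ i, P i j • c i` with `P` over `A` ⇒
  `discr_K c' = (algebraMap A K P.det) ^ 2 * discr_K c` for families in a `K`-algebra `L`
  (`A → K → L` a scalar tower; `Algebra.discr_of_matrix_vecMul`);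
* `exists_unit_discr_eq_of_span_eq` : hence `discr_K c' = u ^ 2 * discr_K c` for a unit `u` of `A`.
-/

namespace Summit.Ventures.HodgeRepro2.T5LatticeBases

open Module Matrix

section Span

variable {A V : Type*} [CommRing A] [AddCommGroup V] [Module A V]
variable {ι : Type*} [Fintype ι] [DecidableEq ι]

/-- Two `A`-linearly independent families `c, c'` spanning the same submodule are related by a
matrix `P` over `A` with unit determinant: `c' j = ∑ i, P i j • c i` (`P = b₁.toMatrix b₂` for
the two bases `Module.Basis.span` of the common span). -/
theorem exists_isUnit_det_of_span_eq {c c' : ι → V} (hc : LinearIndependent A c)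
    (hc' : LinearIndependent A c')
    (h : Submodule.span A (Set.range c') = Submodule.span A (Set.range c)) :
    ∃ P : Matrix ι ι A, IsUnit P.det ∧ ∀ j, c' j = ∑ i, P i j • c i := by
  let b₁ : Basis ι A (Submodule.span A (Set.range c)) := Basis.span hc
  let b₂ : Basis ι A (Submodule.span A (Set.range c)) :=
    (Basis.span hc').map (LinearEquiv.ofEq _ _ h)
  refine ⟨b₁.toMatrix b₂, ?_, ?_⟩
  · rw [← Basis.det_apply]
    exact b₁.isUnit_det b₂
  · intro j
    have hsum := b₁.sum_toMatrix_smul_self b₂ j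
    have h2 : ((b₂ j : Submodule.span A (Set.range c)) : V) = c' j := by
      simp [b₂, Basis.map_apply, LinearEquiv.coe_ofEq_apply]
    have h1 : ∀ i, ((b₁ i : Submodule.span A (Set.range c)) : V) = c i := fun i =>
      Basis.coe_span_apply hc i
    rw [← h2, ← hsum, Submodule.coe_sum]
    simp [h1]

end Span

section Discr

variable {A K L : Type*} [CommRing A] [CommRing K] [CommRing L] [Algebra A K] [Algebra K L]
  [Algebra A L] [IsScalarTower A K L]
variable {ι : Type*} [Fintype ι] [DecidableEq ι]

/-- If `c' j = ∑ i, P i j • c i` with `P` a matrix over `A` (families in a `K`-algebra `L`,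
`A → K → L` a scalar tower), then `discr_K c' = (algebraMap A K P.det) ^ 2 * discr_K c`. -/
theorem discr_eq_of_forall_eq_sum_smul (c c' : ι → L) (P : Matrix ι ι A)
    (h : ∀ j, c' j = ∑ i, P i j • c i) :
    Algebra.discr K c' = algebraMap A K P.det ^ 2 * Algebra.discr K c := by
  have hc' : c' = c ᵥ* (P.map (algebraMap A K)).map (algebraMap K L) := by
    ext j
    rw [h j]
    simp only [Matrix.vecMul, dotProduct, Matrix.map_apply]
    refine Finset.sum_congr rfl fun i _ => ?_
    rw [← IsScalarTower.algebraMap_apply, Algebra.smul_def, mul_comm]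
  rw [hc', Algebra.discr_of_matrix_vecMul, RingHom.map_det, RingHom.mapMatrix_apply]

/-- Two `A`-linearly independent families in `L` spanning the same `A`-lattice have
`K`-discriminants differing by the square of a unit of `A`. -/
theorem exists_unit_discr_eq_of_span_eq {c c' : ι → L} (hc : LinearIndependent A c)
    (hc' : LinearIndependent A c')
    (h : Submodule.span A (Set.range c') = Submodule.span A (Set.range c)) :
    ∃ u : Aˣ, Algebra.discr K c' = algebraMap A K u ^ 2 * Algebra.discr K c := by
  obtain ⟨P, hP, hPc⟩ := exists_isUnit_det_of_span_eq hc hc' h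
  exact ⟨hP.unit, by rw [IsUnit.unit_spec]; exact discr_eq_of_forall_eq_sum_smul c c' P hPc⟩

end Discr

end Summit.Ventures.HodgeRepro2.T5LatticeBases
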